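import Mathlib

/-!
# THEOREM K and LEMMA R — typed statements (bsd-idea-19 g24, 2026-08-29)

Work-file (NOT a Theorems file; imported by nothing; no proofs of the theorems): the precise
finite-combinatorial statements of LEMMA R and THEOREM K of
`Lines/two-parity-modular-unit-note.md` §5, typed over an arbitrary field `F` with a primitive
`M`-th root of unity `ζ`, so that a later formalisation has a fixed target.  The weight is
`k ↦ (k : F)^s` with `s : ℕ` (in the note `s ≡ 1 - 2a (mod p-1)`, e.g. `s = p - 2a`; in
characteristic `p` the terms with `p ∣ k` then vanish automatically, which is the note's
convention `p ∤ k`).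

* `Psi M ζ μ γ x y = Σ_{t : ZMod M} μ((x,t)·γ⁻¹) ζ^{(t y).val}`      (the note's `Ψ^γ(x,y)`),
* `coefK M ζ s μ γ K = Σ_{k ∣ K} (k:F)^s · Psi M ζ μ γ k (K/k)`       (the note's `coef_K(γ)`),
* `rho M D w = 1_{v ≡ w (D)} - (M/D)^{?}·δ_{(M/D)ŵ}` is split into its two indicator parts
  `indMod` and `deltaMul`; LEMMA R is the identity `e^s·coef[indMod] = e·coef[deltaMul]`,
  i.e. `coef[indMod] = e^{1-s}·coef[deltaMul] = e^{2a}·coef[deltaMul]` in the note's normalisation.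

`lemmaR_statement`, `theoremK_statement` are `Prop`-valued `def`s (statements only).  The small
`example`s at the end only check that the definitions compute (`decide`-free sanity).  Nothing here
proves BSD / C5 / R / I9 or the stated theorems.
-/

set_option linter.dupNamespace false

open scoped BigOperators

namespace Summit.BirchSwinnertonDyer.BirchSwinnertonDyer.Cruxes.ManinPrimeToAdditiveFiveLe.TwoParity.Statement

variable {F : Type*} [Field F]

/-- row vector `(x,t)` times the matrix `γ⁻¹`, as a function `Fin 2 → ZMod M` -/
def actInv (M : ℕ) (γ : Matrix.SpecialLinearGroup (Fin 2) (ZMod M)) (x t : ZMod M) :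
    Fin 2 → ZMod M :=
  Matrix.vecMul ![x, t] ((γ⁻¹ : Matrix.SpecialLinearGroup (Fin 2) (ZMod M)) : Matrix (Fin 2) (Fin 2) (ZMod M))

/-- `Ψ^γ(x,y) = Σ_t μ((x,t)γ⁻¹) ζ^{t y}` -/
noncomputable def Psi (M : ℕ) [NeZero M] (ζ : F) (μ : (Fin 2 → ZMod M) → F)
    (γ : Matrix.SpecialLinearGroup (Fin 2) (ZMod M)) (x y : ZMod M) : F :=
  ∑ t : ZMod M, μ (actInv M γ x t) * ζ ^ ((t * y).val)

/-- `coef_K(γ)[μ] = Σ_{k ∣ K} (k:F)^s Ψ^γ(k, K/k)` -/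
noncomputable def coefK (M : ℕ) [NeZero M] (ζ : F) (s : ℕ) (μ : (Fin 2 → ZMod M) → F)
    (γ : Matrix.SpecialLinearGroup (Fin 2) (ZMod M)) (K : ℕ) : F :=
  ∑ k ∈ Nat.divisors K, ((k : F) ^ s) * Psi M ζ μ γ (k : ZMod M) ((K / k : ℕ) : ZMod M)

/-- the indicator `1_{v ≡ w (mod D)}` on `(ℤ/M)²`, for `D ∣ M`, `w ∈ (ℤ/D)²` -/
noncomputable def indMod (M D : ℕ) (w : Fin 2 → ZMod D) : (Fin 2 → ZMod M) → F :=
  fun v => if (fun i => ((v i).val : ZMod D)) = w then 1 else 0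

/-- the indicator `δ_{(M/D)·ŵ}` (`ŵ` = the canonical lift of `w`; the point is lift-independent) -/
noncomputable def deltaMul (M D : ℕ) (w : Fin 2 → ZMod D) : (Fin 2 → ZMod M) → F :=
  fun v => if v = (fun i => ((M / D : ℕ) : ZMod M) * (((w i).val : ℕ) : ZMod M)) then 1 else 0

/-- the generator `ρ_{D,w} = 1_{v≡w (D)} - c·δ_{(M/D)ŵ}` with weight `c` (the note: `c = (M/D)^{2a}`) -/
noncomputable def rho (M D : ℕ) (c : F) (w : Fin 2 → ZMod D) : (Fin 2 → ZMod M) → F :=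
  fun v => indMod (F := F) M D w v - c * deltaMul (F := F) M D w v

/-- LEMMA R (statement): for `ζ` a primitive `M`-th root of unity, `D ∣ M`, every `w`, `γ`, `K`:
`(M/D)^s · coef_K(γ)[1_{v≡w (D)}] = (M/D) · coef_K(γ)[δ_{(M/D)ŵ}]`. -/
def lemmaR_statement (F : Type*) [Field F] (M : ℕ) [NeZero M] (ζ : F) (s : ℕ) : Prop :=
  IsPrimitiveRoot ζ M →
    ∀ (D : ℕ), D ∣ M → ∀ (w : Fin 2 → ZMod D) (γ : Matrix.SpecialLinearGroup (Fin 2) (ZMod M)) (K : ℕ),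
      ((M / D : ℕ) : F) ^ s * coefK M ζ s (indMod (F := F) M D w) γ K
        = ((M / D : ℕ) : F) * coefK M ζ s (deltaMul (F := F) M D w) γ K

/-- the span `R` of the generators `ρ_{D,w}` with weights `c_D = (M/D)^{1-s}` written inverse-free:
we use `c_D := ((M/D : F)^s)⁻¹ * (M/D)` (in the note `= (M/D)^{2a}`). -/
noncomputable def Rspan (F : Type*) [Field F] (M : ℕ) (s : ℕ) : Submodule F ((Fin 2 → ZMod M) → F) :=
  Submodule.span F
    {f | ∃ (D : ℕ) (_ : D ∣ M) (_ : D < M) (w : Fin 2 → ZMod D),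
        f = rho (F := F) M D ((((M / D : ℕ) : F) ^ s)⁻¹ * ((M / D : ℕ) : F)) w}

/-- THEOREM K (statement): `F` of characteristic `p`, `p ∤ M` (forced by the primitive root),
`(p - 1) ∤ s` (the note: `s ≡ 1 - 2a`, odd): a function `μ` on `(ℤ/M)²` all of whose coefficients
`coef_K(γ)[μ]` (`K ≥ 1`, `γ ∈ SL₂(ℤ/M)`) vanish lies in the span `R` of the `ρ_{D,w}`, `D ∣ M`, `D < M`.
(With LEMMA R the converse inclusion holds, so `ker = R`; `codim R = #P(M)`.) -/
def theoremK_statement (F : Type*) [Field F] (p M : ℕ) [Fact p.Prime] [CharP F p] [NeZero M]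
    (ζ : F) (s : ℕ) : Prop :=
  IsPrimitiveRoot ζ M → 5 ≤ p → ¬ (p - 1) ∣ s →
    ∀ μ : (Fin 2 → ZMod M) → F,
      (∀ (K : ℕ), 1 ≤ K → ∀ γ : Matrix.SpecialLinearGroup (Fin 2) (ZMod M), coefK M ζ s μ γ K = 0) →
        μ ∈ Rspan F M s

end Summit.BirchSwinnertonDyer.BirchSwinnertonDyer.Cruxes.ManinPrimeToAdditiveFiveLe.TwoParity.Statement
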